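import Literature.Barriers.QuantumFields.NeubergerZeroOverZero
import Literature.Barriers.QuantumFields.NielsenNinomiyaProofs

/-!
# Discharge of named literature fact(s) by composition

This file only composes reductions and discharges that are already in the tree
(no new definitions, no new named facts): each `theorem X_holds : X` below feeds the
proved hypotheses into an existing reduction theorem.  Net effect: the listed facts
stop being literature debt.
-/

namespace Literature.Barriers.QuantumFields

/-- Discharge of `NeubergerZeroOverZero` from the proved Nielsen–Ninomiya theorem
`NielsenNinomiya_holds` via `NeubergerZeroOverZero_of_nielsenNinomiya`.
[cite: Neuberger1987BRS, (as quoted in Greensite2020Confinement Ch. 10 eq. (10.1), PDF p. 135)] -/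
theorem NeubergerZeroOverZero_holds : NeubergerZeroOverZero :=
  NeubergerZeroOverZero_of_nielsenNinomiya NielsenNinomiya_holds

end Literature.Barriers.QuantumFields
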